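import Summits.NavierStokesRegularity.NavierStokesRegularity.Theorems.EulerZoomLiouvillePowerGaugeEulerLiouvilleWeakEtaRenormalisationMember
import Literature.Analysis.FunctionSpaces.SobolevGradCommutatorLocal
import Literature.Analysis.FunctionSpaces.ContDiffBumpRescale
import HarnessLib

/-!
# Crux `EulerZoomLiouville.PowerGaugeEulerLiouville` (stmt-NavierStokesRegularity-19832), weak stratum, line `weak_axisym` (X1b):
# `stub_etaRenormalisation` UNCONDITIONAL, self-contained (no import of `DiPernaLionsCommutatorHolds`)

Route №10 `EulerZoomLiouville` (NavierStokesRegularity), crux E = stmt-NavierStokesRegularity-19832; width seat ns-ezl-w1 g9 under the LEAD ns-typeII-p2.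
The member `WeakAxisym.etaRenormalisation` (`…WeakEtaRenormalisationMember`, p709301) proves the registered stub `Sig.stub_etaRenormalisation`
of `Cruxes/PowerGaugeEulerLiouville/Lines/weak_axisym.lean` conditionally on the named fact
`Literature.Analysis.FunctionSpaces.DiPernaLionsCommutatorL2` (DiPerna–Lions 1989, Lemma II.1, `L²–W^{1,2}` local form on `ℝ³`, fixed-shape bumps).
That fact is a THEOREM of the tree (`DiPernaLionsCommutatorL2_holds`, file `Literature/…/DiPernaLionsCommutatorHolds.lean`); this file
records the unconditional member WITHOUT importing that module, feeding `etaRenormalisation` the fact's proof term directly from the tree's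
port of the DiPerna–Lions proof, `Literature.Analysis.FunctionSpaces.tendsto_setLIntegral_gradCommutator'` (`SobolevGradCommutatorLocal`),
and the scale invariance of the first gradient moment of fixed-shape kernels (`ContDiffBumpRescale.integral_norm_mul_norm_gradient_normed_bumpRescale`):

* `WeakAxisym.etaRenormalisation_unconditional` — `Sig.stub_etaRenormalisation` δ-unfolded (η general), no hypothesis beyond the stub's.

Fill of the registered stub (kernel-checked against the line file):
`intro ρ hρ hρh V G hG hdiv hη2 hθ; exact …Theorems.PowerGaugeEulerLiouville.WeakAxisym.etaRenormalisation_unconditional hρ hρh hG hdiv hη2 hθ`.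

WHAT THIS IS NOT: not NS, not E, not the crux: X1b is one registered stub of the line `weak_axisym`; 19832 is OPEN.
-/

noncomputable section

-- flat `Theorems/<Route><Decl>…` files of one crux share the namespace of the crux (tree convention)
set_option linter.dupNamespace false

open MeasureTheory Set Filter Topology Metric Function TopologicalSpace ContinuousLinearMap
open scoped ENNReal NNReal RealInnerProductSpace ContDiff Convolution

namespace Summit.NavierStokesRegularity.NavierStokesRegularity.Theorems.PowerGaugeEulerLiouville.WeakAxisym

open Literature.Analysis Literature.Analysis.FunctionSpaces Literature.Analysis.FluidPDE
open Summit.NavierStokesRegularity.NavierStokesRegularity.Theorems.PowerGaugeEulerLiouville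

/-- Two bumps with the same radii are equal (a `ContDiffBump` is determined by `rIn`, `rOut`). [folklore] -/
private theorem contDiffBump_eq_of_radii_eq {E : Type*} [NormedAddCommGroup E] [NormedSpace ℝ E] {c : E}
    {f g : ContDiffBump c} (h1 : f.rIn = g.rIn) (h2 : f.rOut = g.rOut) : f = g := by
  cases f
  cases g
  simp only at h1 h2
  subst h1
  subst h2
  rfl

/-- The first gradient moment `∫ ‖z‖‖∇φ̃(z)‖ dz` of the normalised kernel of a FIXED-SHAPE bump (`rOut = 2·rIn`) centred at `0`
equals that of the reference bump `⟨1, 2⟩`: such a bump IS `bumpRescale ⟨1, 2⟩ (s := rIn⁻¹)`, and the moment is scale invariant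
(`integral_norm_mul_norm_gradient_normed_bumpRescale`). [folklore] -/
private theorem gradientMoment_eq_of_fixedShape (f : ContDiffBump (0 : EuclideanSpace ℝ (Fin 3))) (hf : f.rOut = 2 * f.rIn) :
    ∫ z, ‖z‖ * ‖gradient (f.normed volume) z‖ =
      ∫ z, ‖z‖ * ‖gradient ((⟨1, 2, one_pos, one_lt_two⟩ : ContDiffBump (0 : EuclideanSpace ℝ (Fin 3))).normed volume) z‖ := by
  have e : f = bumpRescale (⟨1, 2, one_pos, one_lt_two⟩ : ContDiffBump (0 : EuclideanSpace ℝ (Fin 3))) (inv_pos.2 f.rIn_pos) := by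
    refine contDiffBump_eq_of_radii_eq ?_ ?_
    · rw [bumpRescale_rIn, div_inv_eq_mul, one_mul]
    · rw [bumpRescale_rOut, div_inv_eq_mul, hf]
  rw [e, integral_norm_mul_norm_gradient_normed_bumpRescale]

/-- **X1b `stub_etaRenormalisation`, UNCONDITIONAL and self-contained** (DiPerna–Lions renormalisation of the damped Casimir law of a weak
self-similar profile): for `η ∈ L²_loc` with `div(W η) = (2γ − 1) η` and `div W = 3γ` in `𝒟′`, `W = γy + V ∈ W^{1,2}_loc`, `γ = 1/(2+ρ)`,
and every `β ∈ C¹` with bounded derivative, `∫ β(η) (3γ ψ + ∂_W ψ) = ∫ ψ (1 + γ) η β′(η)` for all test functions `ψ`.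
Proof: the conditional member `etaRenormalisation` applied to the proof of its named-fact hypothesis `DiPernaLionsCommutatorL2`,
obtained here from the tree's local commutator lemma `tendsto_setLIntegral_gradCommutator'` (any bump family with `rOut → 0` and
eventually bounded first gradient moments; for fixed-shape bumps the moment is constant, `gradientMoment_eq_of_fixedShape`) and the
unfolding `(k ⋆ g)(x) = ∫ k(x − y) g(y) dy` (`convolution_lsmul_eq_integral`). -/
theorem etaRenormalisation_unconditional {ρ : ℝ} (hρ : 0 < ρ) (hρh : ρ ≤ 1 / 2)
    {V : EuclideanSpace ℝ (Fin 3) → EuclideanSpace ℝ (Fin 3)} {G : EuclideanSpace ℝ (Fin 3) → EuclideanSpace ℝ (Fin 3) →L[ℝ] EuclideanSpace ℝ (Fin 3)}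
    {η : EuclideanSpace ℝ (Fin 3) → ℝ}
    (hPG : HasWeakFDerivOn (⊤ : Opens (EuclideanSpace ℝ (Fin 3))) volume V G ∧
      (∀ r : ℝ, MemLp G 2 (volume.restrict (ball (0 : EuclideanSpace ℝ (Fin 3)) r))) ∧
      (∀ r : ℝ, MemLp V 6 (volume.restrict (ball (0 : EuclideanSpace ℝ (Fin 3)) r))) ∧
      HasWeakFDerivOn (⊤ : Opens (EuclideanSpace ℝ (Fin 3))) volume (selfSimilarTransport (1 / (2 + ρ)) 0 V)
        (fun x => (1 / (2 + ρ)) • ContinuousLinearMap.id ℝ (EuclideanSpace ℝ (Fin 3)) + G x))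
    (hdiv : ∀ φ : EuclideanSpace ℝ (Fin 3) → ℝ, IsTestFunctionOn (⊤ : Opens (EuclideanSpace ℝ (Fin 3))) φ →
      ∫ y, ⟪selfSimilarTransport (1 / (2 + ρ)) 0 V y, gradient φ y⟫ = -(3 * (1 / (2 + ρ))) * ∫ y, φ y)
    (hη2 : ∀ r : ℝ, MemLp η 2 (volume.restrict (ball (0 : EuclideanSpace ℝ (Fin 3)) r)))
    (hθ : ∀ ψ : EuclideanSpace ℝ (Fin 3) → ℝ, IsTestFunctionOn (⊤ : Opens (EuclideanSpace ℝ (Fin 3))) ψ →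
      ∫ y, η y * fderiv ℝ ψ y (selfSimilarTransport (1 / (2 + ρ)) 0 V y) = (1 - 2 * (1 / (2 + ρ))) * ∫ y, η y * ψ y) :
    ∀ β : ℝ → ℝ, ContDiff ℝ 1 β → (∃ C : ℝ, ∀ s : ℝ, ‖deriv β s‖ ≤ C) →
      ∀ ψ : EuclideanSpace ℝ (Fin 3) → ℝ, IsTestFunctionOn (⊤ : Opens (EuclideanSpace ℝ (Fin 3))) ψ →
        ∫ y, β (η y) * (3 * (1 / (2 + ρ)) * ψ y + fderiv ℝ ψ y (selfSimilarTransport (1 / (2 + ρ)) 0 V y)) =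
          ∫ y, ψ y * ((1 + 1 / (2 + ρ)) * η y * deriv β (η y)) := by
  refine etaRenormalisation ?_ hρ hρh hPG hdiv hη2 hθ
  -- the named fact `DiPernaLionsCommutatorL2`, from the tree's local commutator lemma
  intro W DW θ hWG hW2 hG2 hθ2 φ hφ hφ2 R
  have hK : ∀ᶠ n in atTop, ∫ z, ‖z‖ * ‖gradient ((φ n).normed volume) z‖ ≤
      ∫ z, ‖z‖ * ‖gradient (((⟨1, 2, one_pos, one_lt_two⟩ : ContDiffBump (0 : EuclideanSpace ℝ (Fin 3)))).normed
        volume) z‖ := Eventually.of_forall fun n => (gradientMoment_eq_of_fixedShape (φ n) (hφ2 n)).le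
  have h := tendsto_setLIntegral_gradCommutator' volume hθ2 hW2 hWG hG2 hφ hK R
  refine (tendsto_congr fun n => ?_).1 h
  refine setLIntegral_congr_fun measurableSet_ball fun x _ => ?_
  rw [convolution_lsmul_eq_integral]
  simp only [mul_assoc]

end Summit.NavierStokesRegularity.NavierStokesRegularity.Theorems.PowerGaugeEulerLiouville.WeakAxisym

end
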